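import Literature.Combinatorics.Games.UniversalTrees

/-!
# Quasi-polynomial universal trees: proof of Theorem 2 of Czerwiński et al. (2019)

This file discharges the named fact `OrderedTree.JurdzinskiLazic2017_universal`
(`Literature/Combinatorics/Games/UniversalTrees.lean`): for all positive `ℓ, h` there is an
`(ℓ, h)`-universal ordered tree with at most `2ℓ · C(⌈lg ℓ⌉ + h + 1, h)` leaves
[CDFJLP19, Thm. 2] (= [JL17]). (The matching lower bound, Theorem 3, is proved in the sibling file
`UniversalTreesProofs.lean`; the two proof files are independent.)

## The proof followed

The SODA paper states Theorem 2 without proof (it cites [JL17], where the tree is the set of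
"succinct codes"). We formalize the equivalent *recursive (self-similar) construction* of universal
trees, exactly as printed in Colcombet–Fijalkow–Gawrychowski–Ohlmann, *The theory of universal graphs
for infinite duration games*, LMCS 18(3:29) 2022, §6.3, Proposition 1 / Theorem 10
[`ColcombetEtAl2021`] (the construction goes back to Fijalkow's report arXiv:1801.09618, subsumed by
the SODA paper):

* `combine L M R` ("`T = T_left ∪ ℓ·T_middle ∪ (T_right + (ℓ+1,0,…,0))`"): merge the roots of `L` and
  `R`, shifting the root-children directions of `R` above those of `L`, and insert in between one new
  child of the root carrying a copy of `M` (`OrderedTree.combine`).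
* Universality (CFGO, proof of Prop. 1): split an arbitrary tree `t` at a root direction `a` into
  the part left of `a` (`leftPart`), the subtree below `a` (`midPart`) and the part right of `a`
  (`rightPart`); choosing `a` so that at most half of the leaves are strictly left and strictly right
  of `a`, the three parts embed into `L`, `M`, `R` by induction, and the three embeddings glue
  (`OrderedTree.isEmbedding_glue`, the map `φ` of CFGO).
* Size: `|combine L M R| ≤ |L| + |M| + |R|`.

We index the recursion by the bit-length `k` (trees with at most `2^k - 1` leaves) instead of `ℓ`:
`univ (k+1) (h+1) = combine (univ k (h+1)) (univ (k+1) h) (univ k (h+1))`, `univ 0 h = univ k 0 = root`.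
Then `|univ k h| ≤ 2^k · C(h + k, k)` by Pascal's rule, and with `k = ⌊lg ℓ⌋ + 1` this is
`≤ 2ℓ · C(⌊lg ℓ⌋ + h + 1, h) ≤ 2ℓ · C(⌈lg ℓ⌉ + h + 1, h)`, the bound of [CDFJLP19, Thm. 2].

## References

* [CDFJLP19] Czerwiński–Daviaud–Fijalkow–Jurdziński–Lazić–Parys, SODA 2019, Thm. 2
  (arXiv:1807.10546 p. 7). [`CzerwinskiEtAl2019`]
* [CFGO22] Colcombet–Fijalkow–Gawrychowski–Ohlmann, LMCS 18(3:29), 2022, §6.3 Prop. 1, Thm. 10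
  (arXiv:2104.05262). [`ColcombetEtAl2021`]
* [JL17] Jurdziński–Lazić, LICS 2017. [`JurdzinskiLazic2017`]
-/

namespace Literature.Combinatorics.Games

namespace OrderedTree

/-! ### Generalities on ordered trees -/

/-- If the root is a leaf then the tree is the root alone. [folklore] -/
theorem eq_nil_of_nil_mem_leaves {t : OrderedTree} (h : [] ∈ t.leaves) {x : List ℕ}
    (hx : x ∈ t.nodes) : x = [] :=
  (mem_leaves.1 h).2 x hx List.nil_prefix

/-- A root-only tree embeds into every ordered tree (by the constant map onto the root). [folklore] -/
theorem isEmbedding_const_nil {t : OrderedTree} (h : [] ∈ t.leaves) (T : OrderedTree) :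
    IsEmbedding t T (fun _ => []) where
  map_nil := rfl
  mapsTo := fun _ _ => T.nil_mem
  map_child := fun x a hx => by simpa using eq_nil_of_nil_mem_leaves h hx
  strictMono := fun x a a' hx _ _ => by simpa using eq_nil_of_nil_mem_leaves h hx

/-- Every (finite, nonempty) ordered tree has a leaf: a node of maximal depth. [folklore] -/
theorem leaves_nonempty (t : OrderedTree) : t.leaves.Nonempty := by
  obtain ⟨x, hx, hmax⟩ := t.nodes.exists_max_image List.length ⟨[], t.nil_mem⟩
  exact ⟨x, mem_leaves.2 ⟨hx, fun y hy hxy =>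
    (hxy.eq_of_length (le_antisymm hxy.length_le (hmax y hy))).symm⟩⟩

/-- A subtree (subset of nodes) is not higher. [folklore] -/
theorem height_le_of_subset {s t : OrderedTree} (h : s.nodes ⊆ t.nodes) : s.height ≤ t.height :=
  Finset.sup_mono h

/-- A nonempty prefix has the same first direction. [folklore] -/
theorem headD_eq_of_isPrefix {x y : List ℕ} (h : x <+: y) (hx : x ≠ []) :
    y.headD 0 = x.headD 0 := by
  cases x with
  | nil => exact (hx rfl).elim
  | cons b l =>
    obtain ⟨z, rfl⟩ := h
    rfl

/-! ### Shifting the first branching direction; merging three trees (CFGO22 §6.3) -/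

/-- Shift the first branching direction of a node by `c` (the translation
`v ↦ v + (c, 0, …, 0)` of CFGO22 §6.3); the root is fixed. [cite: ColcombetEtAl2021, §6.3 Prop. 1] -/
def shiftHead (c : ℕ) : List ℕ → List ℕ
  | [] => []
  | b :: x => (b + c) :: x

/-- `shiftHead` fixes the root. [folklore] -/
@[simp] theorem shiftHead_nil (c : ℕ) : shiftHead c [] = [] := rfl

/-- `shiftHead` on a nonempty node. [folklore] -/
@[simp] theorem shiftHead_cons (c b : ℕ) (x : List ℕ) : shiftHead c (b :: x) = (b + c) :: x := rfl

/-- `shiftHead c` is injective. [folklore] -/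
theorem shiftHead_injective (c : ℕ) : Function.Injective (shiftHead c) := by
  rintro (_ | ⟨b, x⟩) (_ | ⟨b', x'⟩) h
  · rfl
  · simp at h
  · simp at h
  · simp only [shiftHead_cons, List.cons.injEq] at h
    obtain ⟨hb, rfl⟩ := h
    rw [Nat.add_right_cancel hb]

/-- `shiftHead` commutes with appending below a nonempty node. [folklore] -/
theorem shiftHead_append {c : ℕ} {x : List ℕ} (hx : x ≠ []) (y : List ℕ) :
    shiftHead c (x ++ y) = shiftHead c x ++ y := by
  cases x with
  | nil => exact (hx rfl).elim
  | cons b x => rfl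

/-- `shiftHead` preserves the prefix (ancestor) relation. [folklore] -/
theorem isPrefix_shiftHead {x y : List ℕ} (h : x <+: y) (c : ℕ) :
    shiftHead c x <+: shiftHead c y := by
  cases x with
  | nil => exact List.nil_prefix
  | cons b x =>
    obtain ⟨z, rfl⟩ := h
    exact ⟨z, rfl⟩

/-- `shiftHead` preserves the lexicographic order. [folklore] -/
theorem lex_shiftHead {x y : List ℕ} (h : List.Lex (· < ·) x y) (c : ℕ) :
    List.Lex (· < ·) (shiftHead c x) (shiftHead c y) := by
  cases h with
  | nil => exact List.Lex.nil
  | cons h => exact List.Lex.cons h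
  | rel h => exact List.Lex.rel (Nat.add_lt_add_right h c)

/-- A strict bound on the first branching direction of all nodes of `L` ("`ℓ = max_{v ∈ T_left} v_h`"
plus one in CFGO22 §6.3). [cite: ColcombetEtAl2021, §6.3 Prop. 1] -/
def bound (L : OrderedTree) : ℕ :=
  L.nodes.sup (fun x => x.headD 0) + 1

/-- Every first direction of a node of `L` is below `L.bound`. [folklore] -/
theorem lt_bound_of_cons_mem {L : OrderedTree} {b : ℕ} {x : List ℕ} (hx : b :: x ∈ L.nodes) :
    b < L.bound :=
  Nat.lt_succ_of_le (Finset.le_sup (f := fun x : List ℕ => x.headD 0) hx)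

/-- **Merging three trees** (CFGO22 §6.3, proof of Prop. 1:
`T = T_left ∪ ℓ·T_middle ∪ (T_right + (ℓ+1, 0, …, 0))`): the roots of `L` and `R` are merged, the
root children of `R` are shifted above those of `L`, and between them a new child of the root (in
direction `L.bound`) carries a copy of `M`. [cite: ColcombetEtAl2021, §6.3 Prop. 1] -/
def combine (L M R : OrderedTree) : OrderedTree where
  nodes := L.nodes ∪ M.nodes.image (L.bound :: ·) ∪ R.nodes.image (shiftHead (L.bound + 1))
  nil_mem := by simp [L.nil_mem]
  mem_of_isPrefix := by
    intro x y hy hxy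
    simp only [Finset.mem_union, Finset.mem_image] at hy ⊢
    rcases hy with (hy | ⟨m, hm, rfl⟩) | ⟨r, hr, rfl⟩
    · exact Or.inl (Or.inl (L.mem_of_isPrefix hy hxy))
    · rcases List.prefix_cons_iff.1 hxy with rfl | ⟨x', rfl, hx'⟩
      · exact Or.inl (Or.inl L.nil_mem)
      · exact Or.inl (Or.inr ⟨x', M.mem_of_isPrefix hm hx', rfl⟩)
    · cases r with
      | nil =>
        rw [shiftHead_nil, List.prefix_nil] at hxy
        subst hxy
        exact Or.inl (Or.inl L.nil_mem)
      | cons b r =>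
        rcases List.prefix_cons_iff.1 hxy with rfl | ⟨x', rfl, hx'⟩
        · exact Or.inl (Or.inl L.nil_mem)
        · exact Or.inr ⟨b :: x', R.mem_of_isPrefix hr (List.cons_prefix_cons.2 ⟨rfl, hx'⟩), rfl⟩

/-- Nodes of the merged tree. [folklore] -/
theorem mem_combine {L M R : OrderedTree} {x : List ℕ} :
    x ∈ (combine L M R).nodes ↔ x ∈ L.nodes ∨ (∃ m ∈ M.nodes, L.bound :: m = x) ∨
      ∃ r ∈ R.nodes, shiftHead (L.bound + 1) r = x := by
  simp only [combine, Finset.mem_union, Finset.mem_image, or_assoc]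

/-- Leaves of the merged tree come from leaves of the three parts. [folklore] -/
theorem leaves_combine_subset (L M R : OrderedTree) :
    (combine L M R).leaves ⊆
      L.leaves ∪ M.leaves.image (L.bound :: ·) ∪ R.leaves.image (shiftHead (L.bound + 1)) := by
  intro z hz
  obtain ⟨hz, hmax⟩ := mem_leaves.1 hz
  simp only [Finset.mem_union, Finset.mem_image]
  rcases mem_combine.1 hz with hzL | ⟨m, hm, rfl⟩ | ⟨r, hr, rfl⟩
  · exact Or.inl (Or.inl (mem_leaves.2 ⟨hzL, fun y hy hzy => hmax y (mem_combine.2 (Or.inl hy)) hzy⟩))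
  · refine Or.inl (Or.inr ⟨m, mem_leaves.2 ⟨hm, fun y hy hmy => ?_⟩, rfl⟩)
    have := hmax (L.bound :: y) (mem_combine.2 (Or.inr (Or.inl ⟨y, hy, rfl⟩)))
      (List.cons_prefix_cons.2 ⟨rfl, hmy⟩)
    exact (List.cons.inj this).2
  · refine Or.inr ⟨r, mem_leaves.2 ⟨hr, fun y hy hry => ?_⟩, rfl⟩
    exact shiftHead_injective _
      (hmax _ (mem_combine.2 (Or.inr (Or.inr ⟨y, hy, rfl⟩))) (isPrefix_shiftHead hry _))

/-- **Size of the merged tree**: `|T| ≤ |T_left| + |T_middle| + |T_right|` (CFGO22 §6.3, the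
recursion `f(n,h) = f(n,h-1) + f(⌊n/2⌋,h) + f(n-1-⌊n/2⌋,h)`, as an inequality).
[cite: ColcombetEtAl2021, §6.3 Prop. 1] -/
theorem card_leaves_combine (L M R : OrderedTree) :
    (combine L M R).leaves.card ≤ L.leaves.card + M.leaves.card + R.leaves.card :=
  (Finset.card_le_card (leaves_combine_subset L M R)).trans <|
    (Finset.card_union_le _ _).trans <| add_le_add
      ((Finset.card_union_le _ _).trans (add_le_add le_rfl Finset.card_image_le))
      Finset.card_image_le

/-! ### Splitting a tree at a root direction (CFGO22 §6.3: `T'_left, T'_middle, T'_right`) -/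

section parts

variable (t : OrderedTree) (a : ℕ)

/-- `T'_left = {v ∈ T' | v_h < a}`: the root together with the nodes whose first direction is `< a`.
[cite: ColcombetEtAl2021, §6.3 Prop. 1] -/
def leftPart : OrderedTree where
  nodes := t.nodes.filter fun x => x = [] ∨ x.headD 0 < a
  nil_mem := by simp [t.nil_mem]
  mem_of_isPrefix := by
    intro x y hy hxy
    simp only [Finset.mem_filter] at hy ⊢
    refine ⟨t.mem_of_isPrefix hy.1 hxy, ?_⟩
    by_cases hx : x = []
    · exact Or.inl hx
    · have hy' : y ≠ [] := by rintro rfl; exact hx (List.prefix_nil.1 hxy)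
      exact Or.inr (headD_eq_of_isPrefix hxy hx ▸ hy.2.resolve_left hy')

/-- `T'_right = {v ∈ T' | v_h > a}`: the root together with the nodes whose first direction is
`> a`. [cite: ColcombetEtAl2021, §6.3 Prop. 1] -/
def rightPart : OrderedTree where
  nodes := t.nodes.filter fun x => x = [] ∨ a < x.headD 0
  nil_mem := by simp [t.nil_mem]
  mem_of_isPrefix := by
    intro x y hy hxy
    simp only [Finset.mem_filter] at hy ⊢
    refine ⟨t.mem_of_isPrefix hy.1 hxy, ?_⟩
    by_cases hx : x = []
    · exact Or.inl hx
    · have hy' : y ≠ [] := by rintro rfl; exact hx (List.prefix_nil.1 hxy)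
      exact Or.inr (headD_eq_of_isPrefix hxy hx ▸ hy.2.resolve_left hy')

/-- The node set of `T'_middle`: the root and the tails `y` of the nodes `a :: y`. [folklore] -/
def midNodes : Finset (List ℕ) :=
  insert [] ((t.nodes.filter fun x => x.head? = some a).image List.tail)

/-- Membership in `midNodes`. [folklore] -/
theorem mem_midNodes {y : List ℕ} : y ∈ midNodes t a ↔ y = [] ∨ a :: y ∈ t.nodes := by
  simp only [midNodes, Finset.mem_insert, Finset.mem_image, Finset.mem_filter]
  constructor
  · rintro (rfl | ⟨x, ⟨hx, hxa⟩, rfl⟩)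
    · exact Or.inl rfl
    · cases x with
      | nil => simp at hxa
      | cons b l =>
        simp only [List.head?_cons, Option.some.injEq] at hxa
        subst hxa
        exact Or.inr hx
  · rintro (rfl | h)
    · exact Or.inl rfl
    · exact Or.inr ⟨a :: y, ⟨h, rfl⟩, rfl⟩

/-- `T'_middle = {(v_{h-1}, …, v_1) | (a, v_{h-1}, …, v_1) ∈ T'}`: the subtree below the root
child in direction `a`, re-rooted. [cite: ColcombetEtAl2021, §6.3 Prop. 1] -/
def midPart : OrderedTree where
  nodes := midNodes t a
  nil_mem := (mem_midNodes t a).2 (Or.inl rfl)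
  mem_of_isPrefix := by
    intro x y hy hxy
    rw [mem_midNodes] at hy ⊢
    rcases hy with rfl | hy
    · exact Or.inl (List.prefix_nil.1 hxy)
    · exact Or.inr (t.mem_of_isPrefix hy (List.cons_prefix_cons.2 ⟨rfl, hxy⟩))

variable {t a}

/-- Nodes of `leftPart`. [folklore] -/
theorem mem_leftPart {x : List ℕ} :
    x ∈ (leftPart t a).nodes ↔ x ∈ t.nodes ∧ (x = [] ∨ x.headD 0 < a) :=
  Finset.mem_filter

/-- Nodes of `rightPart`. [folklore] -/
theorem mem_rightPart {x : List ℕ} :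
    x ∈ (rightPart t a).nodes ↔ x ∈ t.nodes ∧ (x = [] ∨ a < x.headD 0) :=
  Finset.mem_filter

/-- Nodes of `midPart`. [folklore] -/
theorem mem_midPart {y : List ℕ} : y ∈ (midPart t a).nodes ↔ y = [] ∨ a :: y ∈ t.nodes :=
  mem_midNodes t a

variable (t a)

/-- `T'_left` is not higher than `T'`. [folklore] -/
theorem height_leftPart_le : (leftPart t a).height ≤ t.height :=
  height_le_of_subset (Finset.filter_subset _ _)

/-- `T'_right` is not higher than `T'`. [folklore] -/
theorem height_rightPart_le : (rightPart t a).height ≤ t.height :=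
  height_le_of_subset (Finset.filter_subset _ _)

/-- `T'_middle` has height at most `height T' - 1`. [folklore] -/
theorem height_midPart_le : (midPart t a).height ≤ t.height - 1 := by
  refine Finset.sup_le fun y hy => ?_
  rcases mem_midPart.1 hy with rfl | h
  · simp
  · have := length_le_height h
    rw [List.length_cons] at this
    omega

/-- The number of leaves of `t` strictly left of the root direction `a`. [folklore] -/
def cntLT : ℕ := (t.leaves.filter fun x => x ≠ [] ∧ x.headD 0 < a).card

/-- The number of leaves of `t` strictly right of the root direction `a`. [folklore] -/
def cntGT : ℕ := (t.leaves.filter fun x => x ≠ [] ∧ a < x.headD 0).card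

/-- Unless it is the root alone, `T'_left` has at most `cntLT t a` leaves (its leaves are leaves of
`T'` left of `a`). [folklore] -/
theorem card_leaves_leftPart_le (hl : [] ∉ (leftPart t a).leaves) :
    (leftPart t a).leaves.card ≤ cntLT t a := by
  refine Finset.card_le_card fun x hx => ?_
  obtain ⟨hxn, hmax⟩ := mem_leaves.1 hx
  have hne : x ≠ [] := by rintro rfl; exact hl hx
  obtain ⟨hxt, hxa⟩ := mem_leftPart.1 hxn
  refine Finset.mem_filter.2 ⟨mem_leaves.2 ⟨hxt, fun y hy hxy => hmax y ?_ hxy⟩, hne,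
    hxa.resolve_left hne⟩
  exact mem_leftPart.2 ⟨hy, Or.inr (by rw [headD_eq_of_isPrefix hxy hne]; exact hxa.resolve_left hne)⟩

/-- Unless it is the root alone, `T'_right` has at most `cntGT t a` leaves. [folklore] -/
theorem card_leaves_rightPart_le (hr : [] ∉ (rightPart t a).leaves) :
    (rightPart t a).leaves.card ≤ cntGT t a := by
  refine Finset.card_le_card fun x hx => ?_
  obtain ⟨hxn, hmax⟩ := mem_leaves.1 hx
  have hne : x ≠ [] := by rintro rfl; exact hr hx
  obtain ⟨hxt, hxa⟩ := mem_rightPart.1 hxn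
  refine Finset.mem_filter.2 ⟨mem_leaves.2 ⟨hxt, fun y hy hxy => hmax y ?_ hxy⟩, hne,
    hxa.resolve_left hne⟩
  exact mem_rightPart.2 ⟨hy, Or.inr (by rw [headD_eq_of_isPrefix hxy hne]; exact hxa.resolve_left hne)⟩

/-- Unless it is the root alone, `T'_middle` has at most as many leaves as `T'` (via `y ↦ a :: y`).
[folklore] -/
theorem card_leaves_midPart_le (hm : [] ∉ (midPart t a).leaves) :
    (midPart t a).leaves.card ≤ t.leaves.card := by
  refine Finset.card_le_card_of_injOn (fun y => a :: y) (fun y hy => ?_)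
    (fun y _ y' _ hyy' => (List.cons.inj hyy').2)
  obtain ⟨hyn, hmax⟩ := mem_leaves.1 (Finset.mem_coe.1 hy)
  have hay : a :: y ∈ t.nodes := (mem_midPart.1 hyn).resolve_left (by
    rintro rfl; exact hm (Finset.mem_coe.1 hy))
  refine Finset.mem_coe.2 (mem_leaves.2 ⟨hay, fun z hz hyz => ?_⟩)
  obtain ⟨w, rfl⟩ := hyz
  rw [List.cons_append] at hz ⊢
  rw [hmax (y ++ w) (mem_midPart.2 (Or.inr hz)) (List.prefix_append _ _)]

/-- Leaves strictly left of `a + 1` and strictly right of `a` are disjoint sets of leaves. [folklore] -/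
theorem cntLT_succ_add_cntGT_le : cntLT t (a + 1) + cntGT t a ≤ t.leaves.card := by
  unfold cntLT cntGT
  rw [← Finset.card_filter_add_card_filter_not (s := t.leaves)
    (fun x : List ℕ => x ≠ [] ∧ x.headD 0 < a + 1)]
  refine Nat.add_le_add_left (Finset.card_le_card fun x hx => ?_) _
  simp only [Finset.mem_filter] at hx ⊢
  exact ⟨hx.1, fun h => absurd h.2 (by omega)⟩

/-- Far enough to the right there are no leaves. [folklore] -/
theorem exists_cntGT_le (n : ℕ) : ∃ a, cntGT t a ≤ n := by
  refine ⟨t.leaves.sup fun x => x.headD 0, le_of_eq_of_le ?_ (Nat.zero_le n)⟩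
  refine Finset.card_eq_zero.2 (Finset.filter_eq_empty_iff.2 fun x hx h => ?_)
  exact absurd (Finset.le_sup (f := fun x : List ℕ => x.headD 0) hx) (not_le.2 h.2)

/-- There are no leaves strictly left of direction `0`. [folklore] -/
theorem cntLT_zero : cntLT t 0 = 0 :=
  Finset.card_eq_zero.2 (Finset.filter_eq_empty_iff.2 fun _ _ h => (Nat.not_lt_zero _ h.2).elim)

end parts

/-! ### Gluing three embeddings (CFGO22 §6.3, the map `φ`) -/

/-- The glued map `φ` of CFGO22 §6.3: `φ(v) = φ_left(v)` if `v_h < a`, `B · φ_middle(v_{h-1}, …)` if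
`v_h = a`, and `φ_right(v) + (B + 1, 0, …, 0)` if `v_h > a`. [cite: ColcombetEtAl2021, §6.3 Prop. 1] -/
def glue (a B : ℕ) (fL fM fR : List ℕ → List ℕ) : List ℕ → List ℕ
  | [] => []
  | b :: x => if b < a then fL (b :: x) else if b = a then B :: fM x else shiftHead (B + 1) (fR (b :: x))

/-- `glue` on the root. [folklore] -/
@[simp] theorem glue_nil (a B : ℕ) (fL fM fR : List ℕ → List ℕ) : glue a B fL fM fR [] = [] := rfl

/-- `glue` on a nonempty node. [folklore] -/
theorem glue_cons (a B : ℕ) (fL fM fR : List ℕ → List ℕ) (b : ℕ) (x : List ℕ) :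
    glue a B fL fM fR (b :: x) =
      if b < a then fL (b :: x) else if b = a then B :: fM x else shiftHead (B + 1) (fR (b :: x)) :=
  rfl

/-- **Gluing lemma** (CFGO22 §6.3, "`φ` is indeed a tree-homomorphism from `T'` to `T`"): embeddings
of `T'_left`, `T'_middle`, `T'_right` into `L`, `M`, `R` glue to an embedding of `T'` into
`combine L M R`. [cite: ColcombetEtAl2021, §6.3 Prop. 1] -/
theorem isEmbedding_glue {t L M R : OrderedTree} {a : ℕ} {fL fM fR : List ℕ → List ℕ}
    (hL : IsEmbedding (leftPart t a) L fL) (hM : IsEmbedding (midPart t a) M fM)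
    (hR : IsEmbedding (rightPart t a) R fR) :
    IsEmbedding t (combine L M R) (glue a L.bound fL fM fR) := by
  have memL : ∀ {b : ℕ} {x : List ℕ}, b :: x ∈ t.nodes → b < a → b :: x ∈ (leftPart t a).nodes :=
    fun h hb => mem_leftPart.2 ⟨h, Or.inr hb⟩
  have memM : ∀ {x : List ℕ}, a :: x ∈ t.nodes → x ∈ (midPart t a).nodes :=
    fun h => mem_midPart.2 (Or.inr h)
  have memR : ∀ {b : ℕ} {x : List ℕ}, b :: x ∈ t.nodes → a < b → b :: x ∈ (rightPart t a).nodes :=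
    fun h hb => mem_rightPart.2 ⟨h, Or.inr hb⟩
  -- images of root children: single directions, below `L.bound` on the left
  have headL : ∀ {c : ℕ}, [c] ∈ (leftPart t a).nodes → ∃ b', fL [c] = [b'] ∧ b' < L.bound := by
    intro c hc
    obtain ⟨b', hb'⟩ := hL.map_child (x := []) (a := c) hc
    rw [hL.map_nil] at hb'
    exact ⟨b', hb', lt_bound_of_cons_mem (hb' ▸ hL.mapsTo hc)⟩
  have headR : ∀ {c : ℕ}, [c] ∈ (rightPart t a).nodes → ∃ b', fR [c] = [b'] := by
    intro c hc
    obtain ⟨b', hb'⟩ := hR.map_child (x := []) (a := c) hc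
    rw [hR.map_nil] at hb'
    exact ⟨b', hb'⟩
  -- images of nonempty nodes under `fR` are nonempty
  have neR : ∀ {b : ℕ} {x : List ℕ}, b :: x ∈ (rightPart t a).nodes → fR (b :: x) ≠ [] := by
    intro b x h
    rw [← List.dropLast_append_getLast (List.cons_ne_nil b x)] at h ⊢
    obtain ⟨b', hb'⟩ := hR.map_child h
    rw [hb']
    simp
  refine ⟨rfl, ?_, ?_, ?_⟩
  · -- nodes to nodes
    rintro (_ | ⟨b, x⟩) hx
    · exact (combine L M R).nil_mem
    · rw [glue_cons]
      split_ifs with h₁ h₂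
      · exact mem_combine.2 (Or.inl (hL.mapsTo (memL hx h₁)))
      · subst h₂
        exact mem_combine.2 (Or.inr (Or.inl ⟨_, hM.mapsTo (memM hx), rfl⟩))
      · exact mem_combine.2 (Or.inr (Or.inr ⟨_, hR.mapsTo (memR hx (by omega)), rfl⟩))
  · -- children to children
    rintro (_ | ⟨b, x⟩) c hx
    · simp only [List.nil_append, glue_nil] at hx ⊢
      rw [glue_cons]
      split_ifs with h₁ h₂
      · obtain ⟨b', hb', -⟩ := headL (memL hx h₁)
        exact ⟨b', hb'⟩
      · exact ⟨L.bound, by rw [hM.map_nil]⟩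
      · obtain ⟨b', hb'⟩ := headR (memR hx (by omega))
        exact ⟨b' + (L.bound + 1), by rw [hb']; rfl⟩
    · simp only [List.cons_append] at hx ⊢
      rw [glue_cons, glue_cons]
      split_ifs with h₁ h₂
      · exact hL.map_child (x := b :: x) (a := c) (memL hx h₁)
      · subst h₂
        obtain ⟨b', hb'⟩ := hM.map_child (x := x) (a := c) (memM hx)
        exact ⟨b', by rw [hb']; rfl⟩
      · obtain ⟨b', hb'⟩ := hR.map_child (x := b :: x) (a := c) (memR hx (by omega))
        refine ⟨b', ?_⟩
        have hbx : b :: x ∈ (rightPart t a).nodes :=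
          (rightPart t a).mem_of_isPrefix (memR hx (by omega)) ⟨[c], rfl⟩
        rw [show b :: (x ++ [c]) = b :: x ++ [c] from rfl, hb', shiftHead_append (neR hbx)]
  · -- order-preserving on siblings
    rintro (_ | ⟨b, x⟩) c c' hc hc' hcc'
    · simp only [List.nil_append] at hc hc' ⊢
      rw [glue_cons, glue_cons]
      rcases lt_trichotomy c' a with h' | h' | h'
      · rw [if_pos (hcc'.trans h'), if_pos h']
        exact hL.strictMono (x := []) (memL hc (hcc'.trans h')) (memL hc' h') hcc'
      · rw [if_pos (h' ▸ hcc'), if_neg (by omega), if_pos h', hM.map_nil]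
        obtain ⟨b', hb', hb'B⟩ := headL (memL hc (h' ▸ hcc'))
        rw [hb']
        exact List.Lex.rel hb'B
      · rw [if_neg (c := c' < a) (by omega), if_neg (c := c' = a) (by omega)]
        obtain ⟨b'', hb''⟩ := headR (memR hc' h')
        rcases lt_trichotomy c a with h | h | h
        · rw [if_pos h, hb'', shiftHead_cons]
          obtain ⟨b', hb', hb'B⟩ := headL (memL hc h)
          rw [hb']
          exact List.Lex.rel (by omega)
        · rw [if_neg (by omega), if_pos h, hM.map_nil, hb'', shiftHead_cons]
          exact List.Lex.rel (by omega)
        · rw [if_neg (c := c < a) (by omega), if_neg (c := c = a) (by omega)]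
          exact lex_shiftHead (hR.strictMono (x := []) (memR hc h) (memR hc' h') hcc') _
    · simp only [List.cons_append] at hc hc' ⊢
      rw [glue_cons, glue_cons]
      rcases lt_trichotomy b a with h | h | h
      · rw [if_pos h, if_pos h]
        exact hL.strictMono (x := b :: x) (a := c) (a' := c') (memL hc h) (memL hc' h) hcc'
      · subst h
        rw [if_neg (lt_irrefl _), if_neg (lt_irrefl _), if_pos rfl, if_pos rfl]
        exact List.Lex.cons (hM.strictMono (x := x) (a := c) (a' := c') (memM hc) (memM hc') hcc')
      · rw [if_neg (c := b < a) (by omega), if_neg (c := b = a) (by omega),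
          if_neg (c := b < a) (by omega), if_neg (c := b = a) (by omega)]
        exact lex_shiftHead
          (hR.strictMono (x := b :: x) (a := c) (a' := c') (memR hc h) (memR hc' h) hcc') _

/-! ### The universal trees (CFGO22 §6.3 Prop. 1, indexed by bit-length) -/

/-- Inner recursion on the height, for a fixed family `Uk` of trees of the previous bit-length:
`univAux Uk 0 = root`, `univAux Uk (h+1) = combine (Uk (h+1)) (univAux Uk h) (Uk (h+1))`.
[cite: ColcombetEtAl2021, §6.3 Prop. 1] -/
def univAux (Uk : ℕ → OrderedTree) : ℕ → OrderedTree
  | 0 => root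
  | h + 1 => combine (Uk (h + 1)) (univAux Uk h) (Uk (h + 1))

/-- **The recursive universal trees**: `univ k h` is `(2^k - 1, h)`-universal (`isUniversal_univ`);
`univ 0 h = univ k 0 = root` and `univ (k+1) (h+1) = combine (univ k (h+1)) (univ (k+1) h) (univ k (h+1))`
(CFGO22 §6.3 Prop. 1 with `n = 2^k - 1`, so that `⌊n/2⌋ = ⌈n/2⌉ - 1 = 2^(k-1) - 1`).
[cite: ColcombetEtAl2021, §6.3 Prop. 1] -/
def univ : ℕ → ℕ → OrderedTree
  | 0 => fun _ => root
  | k + 1 => univAux (univ k)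

/-- Unfolding `univ` at bit-length `0`. [folklore] -/
@[simp] theorem univ_zero (h : ℕ) : univ 0 h = root := rfl

/-- Unfolding `univ` at height `0`. [folklore] -/
@[simp] theorem univ_succ_zero (k : ℕ) : univ (k + 1) 0 = root := rfl

/-- Unfolding `univ` (the recursive step). [folklore] -/
theorem univ_succ_succ (k h : ℕ) :
    univ (k + 1) (h + 1) = combine (univ k (h + 1)) (univ (k + 1) h) (univ k (h + 1)) := rfl

/-- **Universality** (CFGO22 §6.3, proof of Prop. 1): `univ k h` is `(2^k - 1, h)`-universal.
[cite: ColcombetEtAl2021, §6.3 Prop. 1] -/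
theorem isUniversal_univ : ∀ k h : ℕ, IsUniversal (2 ^ k - 1) h (univ k h) := by
  intro k
  induction k with
  | zero =>
    intro h t _ ht
    have := (leaves_nonempty t).card_pos
    rw [pow_zero] at ht
    omega
  | succ k ih =>
    intro h
    induction h with
    | zero => exact isUniversal_root _
    | succ h ihh =>
      intro t ht htℓ
      by_cases h0 : [] ∈ t.leaves
      · exact ⟨_, isEmbedding_const_nil h0 _⟩
      -- the split direction `a` (CFGO22: `i₀`): at most `2^k - 1` leaves strictly on either side
      obtain ⟨a, ha, hmin⟩ : ∃ a, cntGT t a ≤ 2 ^ k - 1 ∧ ∀ a' < a, ¬ cntGT t a' ≤ 2 ^ k - 1 :=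
        ⟨Nat.find (exists_cntGT_le t (2 ^ k - 1)), Nat.find_spec (exists_cntGT_le t (2 ^ k - 1)),
          fun a' h => Nat.find_min (exists_cntGT_le t (2 ^ k - 1)) h⟩
      have hlt : cntLT t a ≤ 2 ^ k - 1 := by
        cases a with
        | zero => rw [cntLT_zero]; exact Nat.zero_le _
        | succ a =>
          have h1 := hmin a (Nat.lt_succ_self a)
          have h2 := cntLT_succ_add_cntGT_le t a
          have h3 : 2 ^ (k + 1) = 2 * 2 ^ k := by ring
          omega
      -- the three parts embed by induction (or trivially when reduced to the root)
      obtain ⟨fL, hfL⟩ : ∃ f, IsEmbedding (leftPart t a) (univ k (h + 1)) f := by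
        by_cases hl : [] ∈ (leftPart t a).leaves
        · exact ⟨_, isEmbedding_const_nil hl _⟩
        · exact ih (h + 1) _ ((height_leftPart_le t a).trans ht)
            ((card_leaves_leftPart_le t a hl).trans hlt)
      obtain ⟨fM, hfM⟩ : ∃ f, IsEmbedding (midPart t a) (univ (k + 1) h) f := by
        by_cases hm : [] ∈ (midPart t a).leaves
        · exact ⟨_, isEmbedding_const_nil hm _⟩
        · exact ihh _ (by have := height_midPart_le t a; omega)
            ((card_leaves_midPart_le t a hm).trans htℓ)
      obtain ⟨fR, hfR⟩ : ∃ f, IsEmbedding (rightPart t a) (univ k (h + 1)) f := by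
        by_cases hr : [] ∈ (rightPart t a).leaves
        · exact ⟨_, isEmbedding_const_nil hr _⟩
        · exact ih (h + 1) _ ((height_rightPart_le t a).trans ht)
            ((card_leaves_rightPart_le t a hr).trans ha)
      exact ⟨_, isEmbedding_glue hfL hfM hfR⟩

/-- **Size** (CFGO22 §6.3, Thm. 10 / App. analysis of `f`, in the form needed here):
`|univ k h| ≤ 2^k · C(h + k, k)`, by Pascal's rule. [cite: ColcombetEtAl2021, §6.3 Thm. 10] -/
theorem card_leaves_univ : ∀ k h : ℕ, (univ k h).leaves.card ≤ 2 ^ k * Nat.choose (h + k) k := by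
  intro k
  induction k with
  | zero => intro h; simp [leaves_root]
  | succ k ih =>
    intro h
    induction h with
    | zero =>
      rw [univ_succ_zero, leaves_root, Finset.card_singleton, zero_add, Nat.choose_self, mul_one]
      exact Nat.one_le_two_pow
    | succ h ihh =>
      calc (univ (k + 1) (h + 1)).leaves.card
          ≤ (univ k (h + 1)).leaves.card + (univ (k + 1) h).leaves.card +
              (univ k (h + 1)).leaves.card := card_leaves_combine _ _ _
        _ ≤ 2 ^ k * Nat.choose (h + 1 + k) k + 2 ^ (k + 1) * Nat.choose (h + (k + 1)) (k + 1) +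
              2 ^ k * Nat.choose (h + 1 + k) k := add_le_add (add_le_add (ih _) ihh) (ih _)
        _ = 2 ^ (k + 1) * Nat.choose (h + 1 + (k + 1)) (k + 1) := by
          rw [show h + 1 + (k + 1) = (h + k + 1) + 1 by omega, Nat.choose_succ_succ,
            show h + 1 + k = h + k + 1 by omega, show h + (k + 1) = h + k + 1 by omega]
          ring

/-- **Theorem 2 of Czerwiński et al. (2019) / Jurdziński–Lazić (2017)**, discharging the named fact
`JurdzinskiLazic2017_universal`: for all positive `ℓ` and `h` there is an `(ℓ, h)`-universal ordered
tree with at most `2ℓ · C(⌈lg ℓ⌉ + h + 1, h)` leaves. The witness is `univ (⌊lg ℓ⌋ + 1) h`, which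
has at most `2^(⌊lg ℓ⌋+1) · C(⌊lg ℓ⌋ + h + 1, h) ≤ 2ℓ · C(⌈lg ℓ⌉ + h + 1, h)` leaves.
[cite: CzerwinskiEtAl2019, Thm. 2] -/
theorem JurdzinskiLazic2017_universal_holds : JurdzinskiLazic2017_universal := by
  intro ℓ h hℓ _hh
  refine ⟨univ (Nat.log 2 ℓ + 1) h, (isUniversal_univ _ _).mono ?_ le_rfl,
    (card_leaves_univ _ _).trans (Nat.mul_le_mul ?_ ?_)⟩
  · have : ℓ < 2 ^ (Nat.log 2 ℓ + 1) := Nat.lt_pow_succ_log_self Nat.one_lt_two ℓ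
    omega
  · rw [pow_succ']
    exact Nat.mul_le_mul_left 2 (Nat.pow_log_le_self 2 hℓ.ne')
  · rw [← Nat.choose_symm_add]
    exact Nat.choose_le_choose h (by have := Nat.log_le_clog 2 ℓ; omega)

end OrderedTree

end Literature.Combinatorics.Games
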